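import Summits.RiemannHypothesis.RiemannHypothesis.Theorems.HardyZLehmerSplitSigmaLLaguerreConeDecrement
import Summits.RiemannHypothesis.RiemannHypothesis.Theorems.SigmaLNoViolation
import Summits.RiemannHypothesis.RiemannHypothesis.Theorems.HardyZLehmerSplitSigmaLSmooth
import Summits.RiemannHypothesis.RiemannHypothesis.Theorems.HardyZLehmerSplitSigmaLstub_secondDerivTest
import Mathlib.Analysis.Calculus.Deriv.Slope
import HarnessLib

/-!
# Crux `SigmaL` (stmt-RiemannHypothesis-24253) — the CONE THEOREM: `Z·Z'' < 0` at a critical point of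
# Hardy's `Z` unless an OFF-line zero of `ζ` sits (almost) directly above it

Skeleton `SigmaL_birth`, registered stub

  `stub_laguerreAtCritical : ∀ t > 3·10¹², Z'(t) = 0 → Z(t) ≠ 0 → Z(t)·Z''(t) < 0`

(`Z = Literature.NumberTheory.LFunctions.hardyZ`). RH-free the stub is open (RH-strength): above the
Platt–Trudgian height nobody controls the zeros of `ζ`. The window theorem
`laguerreAtCritical_of_onLine` (`Theorems/HardyZLehmerSplitSigmaLLaguerreOfOnLine.lean`) derives the
stub's conclusion at `t` from "every zero of `ζ` with ordinate in `(t − 3/2, t + 9)` is on the line".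
This module (route-independent imports only) SHARPENS that to the geometry that matters:

* §4 **Cone theorem** (`laguerreAtCritical_of_offCone`, RH-free): at a critical point `t ≥ 3·10¹²`
  of `Z` with `Z(t) ≠ 0`, if every zero `β + iγ` of `ζ` with `|γ − t| < 1` is on the line OR has
  `2|β − ½| < |γ − t|` (`t` outside its DOUBLED CONE), then `Z(t)·Z''(t) < 0`. Engine: the cone
  decrement of `Z'/Z` (`logDeriv_decrement_cone`,
  `Theorems/HardyZLehmerSplitSigmaLLaguerreConeDecrement.lean`) + finiteness of the zeros near `t`
  (`zetaZeroBox_finite`) + one zero within `8` (`SigmaLRung.zetaZeroCount_lt_add_eight`, RH-free).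
* §5 **Cone locators** (contrapositives, unconditional): a wrong-curvature or degenerate critical
  point of `Z`, in particular a positive local minimum or a negative local maximum (Lehmer
  violation), at `t ≥ 3·10¹²` forces a zero `β + iγ` of `ζ` OFF the line with `|γ − t| ≤ 2|β − ½|`
  (`< 1`): violations can only sit beneath off-line zeros, inside their doubled cones
  (`exists_offLine_zero_cone_of_laguerre_violation`, `exists_offLine_zero_cone_of_lehmer_violation`;
  the earlier locators gave the ordinate window `(t − 3/2, t + 9)` only).
* §6 **No violation at `t` off the cones** (`noViolationAt_of_offCone`, the crux's clause at `t`) and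
  the **unit-padding** window versions (`laguerreAtCritical_of_onLine_unit`,
  `laguerreAtCritical_of_onLine'`, `noViolationOn_of_onLine'`: zeros with ordinate in `(A − 1, B + 1)`
  on the line suffice — was `(A − ½, B + 8]`).

So the RH-free open part of the stub is, precisely: "above the Platt–Trudgian height, no critical
point of `Z` with `Z ≠ 0` lies in the doubled cone of an off-line zero" — still RH-strength as a
whole (every off-line zero's cone covers its own ordinate), but LOCAL. NOTHING HERE PROVES OR ASSUMES
RH; the stub stays OPEN. References: Ivić 2003 §2 Prop. 1 [Ivic2003]; Edwards 1974 §8.3 [Edwards1974].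
-/

set_option linter.dupNamespace false
set_option autoImplicit false

noncomputable section

open Complex Filter Set
open scoped Real Topology
open Literature.NumberTheory.LFunctions
open Summit.RiemannHypothesis.RiemannHypothesis.Theorems.SigmaLRung

namespace Summit.RiemannHypothesis.RiemannHypothesis.Theorems.SigmaLBirth

/-! ## §4. The cone theorem -/

/-- **CONE THEOREM (RH-free).** Let `t ≥ 3·10¹²` be a critical point of Hardy's `Z` (`Z'(t) = 0`)
with `Z(t) ≠ 0`. If every zero `s = β + iγ` of `ζ` with `|γ − t| < 1` is on the critical line or
has `t` outside its doubled cone, `2|β − ½| < |γ − t|`, then `Z(t)·Z''(t) < 0`.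
Proof: the zeros with `|γ − t| < 1` are finitely many (`zetaZeroBox_finite`), so on a small interval
around `t` (also zero-free for `Z`) every pair of points `t₁ < t₂` satisfies the cone condition of
`pairTerm_sub_nonneg_of_cone` for every zero (zeros with `|γ − t| ≥ 1` have `|β − ½| < ½ ≤` their
distance); the RH-free count `SigmaLRung.zetaZeroCount_lt_add_eight` supplies a zero `ρ₀` with
`t < γ₀ ≤ t + 8`, outside its doubled cone; so `Z'/Z` drops at rate `≥ 1/(3·9²) − 4/(t − ½) > 0`
there (`logDeriv_decrement_cone`), and `Z''(t)/Z(t) = (Z'/Z)'(t)` is the limit of slopes all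
`≤ −rate`. Nothing here bears on the truth of RH.
[cite: Ivic2003, §2 Prop. 1 (cone form, at critical points)] -/
theorem laguerreAtCritical_of_offCone {t : ℝ} (ht : 3000000000000 ≤ t)
    (hcone : ∀ s : ℂ, riemannZeta s = 0 → |s.im - t| < 1 →
      s.re = 1 / 2 ∨ 2 * |s.re - 1 / 2| < |s.im - t|)
    (hd : deriv hardyZ t = 0) (hZ : hardyZ t ≠ 0) :
    hardyZ t * deriv (deriv hardyZ) t < 0 := by
  -- (1) the rate zero `ρ₀`, `t < γ₀ ≤ t + 8`, outside its doubled cone at `t`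
  obtain ⟨ρ₀, hρ₀, hγ₀t, hγ₀8⟩ :=
    exists_zero_of_count_lt (by norm_num) (zetaZeroCount_lt_add_eight ht)
  obtain ⟨h0, h1⟩ := re_mem_Ioo_of_riemannZeta_eq_zero_of_im_ne_zero hρ₀
    (by intro h; rw [h] at hγ₀t; linarith)
  have hdc₀ : 2 * |ρ₀.re - 1 / 2| < ρ₀.im - t := by
    by_cases hlt1 : ρ₀.im - t < 1
    · rcases hcone ρ₀ hρ₀ (by rw [abs_lt]; constructor <;> linarith) with h | h
      · rw [h]; norm_num; linarith
      · rwa [abs_of_pos (by linarith : 0 < ρ₀.im - t)] at h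
    · push Not at hlt1
      have : |ρ₀.re - 1 / 2| < 1 / 2 := by rw [abs_lt]; constructor <;> linarith
      linarith
  -- (2) `Z ≠ 0` near `t`
  obtain ⟨ε, hε, hball⟩ :=
    Metric.eventually_nhds_iff.1 ((continuous_hardyZ.continuousAt (x := t)).eventually_ne hZ)
  -- (3) the finitely many zeros with ordinate within `1` of `t`
  set F : Set ℂ := {s | riemannZeta s = 0 ∧ |s.im - t| < 1} with hF
  have hFfin : F.Finite := by
    refine (zetaZeroBox_finite 0 (t + 1)).subset ?_
    rintro s ⟨hs, hst⟩
    rw [abs_lt] at hst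
    obtain ⟨hr0, hr1⟩ := re_mem_Ioo_of_riemannZeta_eq_zero_of_im_ne_zero hs
      (by intro h; rw [h] at hst; linarith [hst.1])
    exact ⟨hs, hr0.le, hr1.le, by linarith, by linarith⟩
  -- (4) eventually near `t`: off the cone of every `s ∈ F`, on the side of `t`; off the doubled
  -- cone of `ρ₀`; inside the `Z ≠ 0` ball (then also within `½` of `t`)
  have hevF : ∀ᶠ u in 𝓝 t, ∀ s ∈ F, s.re = 1 / 2 ∨
      (|s.re - 1 / 2| < |u - s.im| ∧ 0 < (u - s.im) * (t - s.im)) := by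
    rw [hFfin.eventually_all]
    rintro s ⟨hs, hst⟩
    rcases hcone s hs hst with h | h
    · exact Filter.Eventually.of_forall fun u ↦ Or.inl h
    · have habs : 0 ≤ |s.re - 1 / 2| := abs_nonneg _
      have h1' : |s.re - 1 / 2| < |t - s.im| := by rw [abs_sub_comm t s.im]; linarith
      have hne : t - s.im ≠ 0 := by
        intro h0'
        rw [h0', abs_zero] at h1'
        linarith
      have h2' : 0 < (t - s.im) * (t - s.im) := mul_self_pos.2 hne
      have c1 : ContinuousAt (fun u : ℝ ↦ |u - s.im|) t := by fun_prop
      have c2 : ContinuousAt (fun u : ℝ ↦ (u - s.im) * (t - s.im)) t := by fun_prop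
      filter_upwards [c1.eventually (lt_mem_nhds h1'), c2.eventually (lt_mem_nhds h2')]
        with u hu1 hu2
      exact Or.inr ⟨hu1, hu2⟩
  have hev0 : ∀ᶠ u in 𝓝 t, 2 * |ρ₀.re - 1 / 2| < ρ₀.im - u := by
    have c : ContinuousAt (fun u : ℝ ↦ ρ₀.im - u) t := by fun_prop
    exact c.eventually (lt_mem_nhds hdc₀)
  have hevε : ∀ᶠ u in 𝓝 t, dist u t < ε := Metric.ball_mem_nhds t hε
  obtain ⟨η₀, hη₀, hη₀all⟩ := Metric.eventually_nhds_iff.1 (hevF.and (hev0.and hevε))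
  set η : ℝ := min η₀ (1 / 2) with hη
  have hηpos : 0 < η := lt_min hη₀ (by norm_num)
  have hη₀le : η ≤ η₀ := min_le_left _ _
  have hη12 : η ≤ 1 / 2 := min_le_right _ _
  have hmem : ∀ u ∈ Ioo (t - η) (t + η), dist u t < η₀ ∧ |u - t| < 1 / 2 := by
    intro u hu
    have : |u - t| < η := by rw [abs_lt]; constructor <;> linarith [hu.1, hu.2]
    exact ⟨by rw [Real.dist_eq]; linarith, by linarith⟩
  have hfree : ∀ u ∈ Ioo (t - η) (t + η), hardyZ u ≠ 0 := fun u hu ↦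
    hball ((hη₀all (hmem u hu).1).2.2)
  -- (5) the linear decrement of `Z'/Z` on `(t − η, t + η)`, rate `c = 1/243 − 4/(t − η) > 0`
  set c : ℝ := 1 / (3 * (9 : ℝ) ^ 2) - 4 / (t - η) with hc
  have hcpos : 0 < c := by
    rw [hc, sub_pos, div_lt_div_iff₀ (by linarith) (by norm_num)]
    linarith
  have hdec : ∀ t₁ t₂ : ℝ, t₁ ∈ Ioo (t - η) (t + η) → t₂ ∈ Ioo (t - η) (t + η) → t₁ < t₂ →
      (t₂ - t₁) * c ≤ deriv hardyZ t₁ / hardyZ t₁ - deriv hardyZ t₂ / hardyZ t₂ := by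
    intro t₁ t₂ ht₁ ht₂ hlt
    obtain ⟨hd₁, h12₁⟩ := hmem t₁ ht₁
    obtain ⟨hd₂, h12₂⟩ := hmem t₂ ht₂
    obtain ⟨hF₁, -, -⟩ := hη₀all hd₁
    obtain ⟨hF₂, h0₂, -⟩ := hη₀all hd₂
    rw [abs_lt] at h12₁ h12₂
    refine logDeriv_decrement_cone (ρ₀ := ρ₀) (C₀ := 9) (by linarith) hfree ht₁ ht₂ hlt ?_ hρ₀ h0
      h1 (by linarith [abs_nonneg (ρ₀.re - 1 / 2)]) (by linarith) ?_
    · -- the cone condition at `(t₁, t₂)` for every zero in the strip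
      intro s hs hr0 hr1
      have hβ : |s.re - 1 / 2| < 1 / 2 := by rw [abs_lt]; constructor <;> linarith
      have hsq : (s.re - 1 / 2) ^ 2 = |s.re - 1 / 2| * |s.re - 1 / 2| := by
        rw [← sq, sq_abs]
      by_cases hsF : |s.im - t| < 1
      · have hs' : s ∈ F := ⟨hs, hsF⟩
        rcases hF₁ s hs' with h | ⟨ha₁, hb₁⟩
        · exact Or.inl h
        rcases hF₂ s hs' with h | ⟨ha₂, hb₂⟩
        · exact Or.inl h
        right
        have hprod : 0 < (t₁ - s.im) * (t₂ - s.im) := by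
          have hm := mul_pos hb₁ hb₂
          have e : (t₁ - s.im) * (t - s.im) * ((t₂ - s.im) * (t - s.im)) =
              (t₁ - s.im) * (t₂ - s.im) * (t - s.im) ^ 2 := by ring
          rw [e] at hm
          exact pos_of_mul_pos_left hm (sq_nonneg _)
        have habs := abs_nonneg (s.re - 1 / 2)
        have hlt' := mul_lt_mul'' ha₁ ha₂ habs habs
        rw [← abs_mul (t₁ - s.im) (t₂ - s.im), abs_of_pos hprod] at hlt'
        rwa [hsq]
      · push Not at hsF
        right
        have habs := abs_nonneg (s.re - 1 / 2)
        have hq : |s.re - 1 / 2| * |s.re - 1 / 2| < 1 / 2 * (1 / 2) :=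
          mul_lt_mul'' hβ hβ habs habs
        rw [hsq]
        rcases le_abs'.1 hsF with hle | hle
        · -- `s.im ≤ t − 1`
          have a1 : 1 / 2 ≤ t₁ - s.im := by linarith
          have a2 : 1 / 2 ≤ t₂ - s.im := by linarith
          have := mul_le_mul a1 a2 (by norm_num) (by linarith)
          linarith
        · -- `t + 1 ≤ s.im`
          have a1 : 1 / 2 ≤ s.im - t₁ := by linarith
          have a2 : 1 / 2 ≤ s.im - t₂ := by linarith
          have := mul_le_mul a1 a2 (by norm_num) (by linarith)
          have e : (t₁ - s.im) * (t₂ - s.im) = (s.im - t₁) * (s.im - t₂) := by ring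
          linarith
    · -- the doubled cone of `ρ₀` at `t₂`
      have hx : 0 ≤ 2 * |ρ₀.re - 1 / 2| := by positivity
      have hsq := mul_lt_mul'' h0₂ h0₂ hx hx
      have e : 2 * |ρ₀.re - 1 / 2| * (2 * |ρ₀.re - 1 / 2|) = 4 * (ρ₀.re - 1 / 2) ^ 2 := by
        rw [show (ρ₀.re - 1 / 2) ^ 2 = |ρ₀.re - 1 / 2| ^ 2 from (sq_abs _).symm]; ring
      rw [e, ← sq] at hsq
      exact hsq.le
  -- (6) `Z''(t)/Z(t) = (Z'/Z)'(t)` is the limit of the slopes of `Z'/Z` at `t`, all `≤ −c`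
  have hder : HasDerivAt (fun s ↦ deriv hardyZ s / hardyZ s)
      (deriv (deriv hardyZ) t / hardyZ t) t := by
    have h := (hasDerivAt_deriv_hardyZ t).div (differentiable_hardyZ t).hasDerivAt hZ
    have e : (deriv (deriv hardyZ) t * hardyZ t - deriv hardyZ t * deriv hardyZ t) /
        hardyZ t ^ 2 = deriv (deriv hardyZ) t / hardyZ t := by
      rw [hd, mul_zero, sub_zero, sq, mul_div_mul_right _ _ hZ]
    rw [e] at h
    exact h
  have hle : deriv (deriv hardyZ) t / hardyZ t ≤ -c := by
    have hslope := hasDerivAt_iff_tendsto_slope.mp hder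
    have htmem : t ∈ Ioo (t - η) (t + η) := ⟨by linarith, by linarith⟩
    have hev : ∀ᶠ s in 𝓝[≠] t, slope (fun s ↦ deriv hardyZ s / hardyZ s) t s ≤ -c := by
      have hmem' : Ioo (t - η) (t + η) ∈ 𝓝[≠] t :=
        mem_nhdsWithin_of_mem_nhds (Ioo_mem_nhds (by linarith) (by linarith))
      filter_upwards [hmem', self_mem_nhdsWithin] with s hs hne
      rw [slope_def_field]
      rcases lt_or_gt_of_ne hne with h | h
      · have hd' := hdec s t hs htmem h
        rw [div_le_iff_of_neg (sub_neg.2 h)]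
        linarith
      · have hd' := hdec t s htmem hs h
        rw [div_le_iff₀ (sub_pos.2 h)]
        linarith
    exact le_of_tendsto hslope hev
  have hq : deriv (deriv hardyZ) t / hardyZ t < 0 := by linarith
  have hZsq : 0 < hardyZ t ^ 2 := by positivity
  have e : hardyZ t * deriv (deriv hardyZ) t =
      (deriv (deriv hardyZ) t / hardyZ t) * hardyZ t ^ 2 := by
    field_simp
  rw [e]
  exact mul_neg_of_neg_of_pos hq hZsq

/-! ## §5. Cone locators (contrapositives; unconditional, RH-free) -/

/-- **CONE LOCATOR for Laguerre violations (unconditional).** A wrong-curvature or degenerate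
critical point of Hardy's `Z` at `t ≥ 3·10¹²` (`Z'(t) = 0`, `Z(t) ≠ 0`, `Z(t)·Z''(t) ≥ 0`) forces a
zero `β + iγ` of `ζ` OFF the critical line whose doubled cone covers `t`: `|γ − t| ≤ 2|β − ½|`
(`< 1`). Contrapositive of `laguerreAtCritical_of_offCone`: violations of the Laguerre inequality at
critical points can only sit (almost) directly beneath off-line zeros. (Sharpens the locator
`exists_offLine_zero_near_of_laguerre_violation`, ordinate window `(t − 3/2, t + 9)`.) Nothing is
assumed about RH. [cite: Ivic2003, §2 Prop. 1 (contrapositive, cone form)] -/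
theorem exists_offLine_zero_cone_of_laguerre_violation {t : ℝ} (ht : 3000000000000 ≤ t)
    (hd : deriv hardyZ t = 0) (hZ : hardyZ t ≠ 0) (hviol : 0 ≤ hardyZ t * deriv (deriv hardyZ) t) :
    ∃ s : ℂ, riemannZeta s = 0 ∧ s.re ≠ 1 / 2 ∧ |s.im - t| ≤ 2 * |s.re - 1 / 2| ∧
      |s.im - t| < 1 := by
  by_contra h
  push Not at h
  refine absurd (laguerreAtCritical_of_offCone ht (fun s hs hst ↦ ?_) hd hZ) (not_lt.2 hviol)
  by_cases hre : s.re = 1 / 2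
  · exact Or.inl hre
  · rcases lt_or_ge (2 * |s.re - 1 / 2|) |s.im - t| with hlt | hge
    · exact Or.inr hlt
    · exact absurd (h s hs hre hge) (not_le.2 hst)

/-- **CONE LOCATOR for Lehmer violations (unconditional).** A positive local minimum or a negative
local maximum of Hardy's `Z` at `t ≥ 3·10¹²` forces a zero `β + iγ` of `ζ` OFF the critical line with
`|γ − t| ≤ 2|β − ½|` (`< 1`): by the second-derivative test (`stub_secondDerivTest`) such a `t` is a
critical point with `Z ≠ 0` and `Z·Z'' ≥ 0`. Ivić's criterion (a Lehmer violation refutes RH) made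
LOCAL to the doubled cone. Nothing is assumed about RH.
[cite: Ivic2003, §2 Prop. 1 (contrapositive, cone form)] -/
theorem exists_offLine_zero_cone_of_lehmer_violation {t : ℝ} (ht : 3000000000000 ≤ t)
    (hviol : (IsLocalMin hardyZ t ∧ 0 < hardyZ t) ∨ (IsLocalMax hardyZ t ∧ hardyZ t < 0)) :
    ∃ s : ℂ, riemannZeta s = 0 ∧ s.re ≠ 1 / 2 ∧ |s.im - t| ≤ 2 * |s.re - 1 / 2| ∧
      |s.im - t| < 1 := by
  rcases hviol with ⟨hmin, hpos⟩ | ⟨hmax, hneg⟩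
  · obtain ⟨hd, hdd⟩ := (stub_secondDerivTest t).1 hmin
    exact exists_offLine_zero_cone_of_laguerre_violation ht hd hpos.ne' (mul_nonneg hpos.le hdd)
  · obtain ⟨hd, hdd⟩ := (stub_secondDerivTest t).2 hmax
    exact exists_offLine_zero_cone_of_laguerre_violation ht hd hneg.ne
      (mul_nonneg_of_nonpos_of_nonpos hneg.le hdd)

/-! ## §6. No violation at `t` off the cones; the unit-padding window versions -/

/-- **No Lehmer violation at `t` off the cones:** for `t ≥ 3·10¹²`, if every zero `β + iγ` of `ζ` with
`|γ − t| < 1` is on the line or has `2|β − ½| < |γ − t|`, then a local minimum of `Z` at `t` has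
`Z(t) ≤ 0` and a local maximum has `Z(t) ≥ 0` (the crux `SigmaL`'s clause AT `t`; cone theorem +
second-derivative test). RH-free; nothing here bears on the truth of RH. -/
theorem noViolationAt_of_offCone {t : ℝ} (ht : 3000000000000 ≤ t)
    (hcone : ∀ s : ℂ, riemannZeta s = 0 → |s.im - t| < 1 →
      s.re = 1 / 2 ∨ 2 * |s.re - 1 / 2| < |s.im - t|) :
    (IsLocalMin hardyZ t → hardyZ t ≤ 0) ∧ (IsLocalMax hardyZ t → 0 ≤ hardyZ t) := by
  refine ⟨fun hmin ↦ ?_, fun hmax ↦ ?_⟩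
  · by_contra hpos
    push Not at hpos
    obtain ⟨hd, hdd⟩ := (stub_secondDerivTest t).1 hmin
    have := laguerreAtCritical_of_offCone ht hcone hd hpos.ne'
    nlinarith [mul_nonneg hpos.le hdd]
  · by_contra hneg
    push Not at hneg
    obtain ⟨hd, hdd⟩ := (stub_secondDerivTest t).2 hmax
    have := laguerreAtCritical_of_offCone ht hcone hd hneg.ne
    nlinarith [mul_nonneg_of_nonpos_of_nonpos hneg.le hdd]

/-- **Unit padding, pointwise:** at a critical point `t ≥ 3·10¹²` of `Z` with `Z(t) ≠ 0`,
`Z(t)·Z''(t) < 0` as soon as the zeros of `ζ` with ordinate in `(t − 1, t + 1)` are on the line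
(the window theorem `laguerreAtCritical_of_onLine` needed `(t − 3/2, t + 9)`). RH-free given the
window hypothesis; nothing here bears on the truth of RH. -/
theorem laguerreAtCritical_of_onLine_unit {t : ℝ} (ht : 3000000000000 ≤ t)
    (hline : ∀ s : ℂ, riemannZeta s = 0 → t - 1 < s.im → s.im < t + 1 → s.re = 1 / 2)
    (hd : deriv hardyZ t = 0) (hZ : hardyZ t ≠ 0) :
    hardyZ t * deriv (deriv hardyZ) t < 0 :=
  laguerreAtCritical_of_offCone ht (fun s hs hst ↦ by
    rw [abs_lt] at hst
    exact Or.inl (hline s hs (by linarith) (by linarith))) hd hZ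

/-- **`Z·Z'' < 0` at the critical points of `Z` in `(A, B)` (`A ≥ 3·10¹²`) from the zeros of `ζ`
with ordinate in `(A', B') ⊇ (A − 1, B + 1)` being on the line** (unit padding; the earlier window
theorem `laguerreAtCritical_of_onLine` needed `(A − ½, B + 8]`). RH-free given the window hypothesis;
nothing here bears on the truth of RH. [cite: Ivic2003, §2 Prop. 1 (localised, unit padding)] -/
theorem laguerreAtCritical_of_onLine' {A B A' B' : ℝ} (hA : 3000000000000 ≤ A)
    (hA' : A' ≤ A - 1) (hB' : B + 1 ≤ B')
    (hline : ∀ s : ℂ, riemannZeta s = 0 → A' < s.im → s.im < B' → s.re = 1 / 2) :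
    ∀ t : ℝ, A < t → t < B → deriv hardyZ t = 0 → hardyZ t ≠ 0 →
      hardyZ t * deriv (deriv hardyZ) t < 0 :=
  fun t hAt htB hd hZ ↦ laguerreAtCritical_of_onLine_unit (by linarith)
    (fun s hs h1 h2 ↦ hline s hs (by linarith) (by linarith)) hd hZ

/-- **Σ_L on `(A, B)` from the zeros with ordinate in `(A', B') ⊇ (A − 1, B + 1)` being on the line**
(`A ≥ 3·10¹²`; unit padding — `SigmaLRung.noViolationOn_of_onLine` needed `(A − ½, B + 8]`): no
positive local minimum and no negative local maximum of `Z` in `(A, B)`. RH-free given the window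
hypothesis; nothing here bears on the truth of RH. [cite: Ivic2003, §2 Prop. 1 (localised, unit padding)] -/
theorem noViolationOn_of_onLine' {A B A' B' : ℝ} (hA : 3000000000000 ≤ A)
    (hA' : A' ≤ A - 1) (hB' : B + 1 ≤ B')
    (hline : ∀ s : ℂ, riemannZeta s = 0 → A' < s.im → s.im < B' → s.re = 1 / 2) :
    ∀ t : ℝ, A < t → t < B →
      (IsLocalMin hardyZ t → hardyZ t ≤ 0) ∧ (IsLocalMax hardyZ t → 0 ≤ hardyZ t) :=
  fun t hAt htB ↦ noViolationAt_of_offCone (by linarith) fun s hs hst ↦ by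
    rw [abs_lt] at hst
    exact Or.inl (hline s hs (by linarith) (by linarith))

end Summit.RiemannHypothesis.RiemannHypothesis.Theorems.SigmaLBirth

end
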